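import Summits.ResolutionOfSingularities.ResolutionOfSingularities.Theorems.PurelyInseparableDim4SwapTransportWindowCorePrime
import Summits.ResolutionOfSingularities.ResolutionOfSingularities.Theorems.PurelyInseparableDim4SwapTransportWindowFramePrime
import Summits.ResolutionOfSingularities.ResolutionOfSingularities.Theorems.PurelyInseparableDim4ResConeCInfPinningUTwoStateRowPrime
import HarnessLib
import HarnessLib.Audit.Tags

/-!
# Purely inseparable four-folds — ONE STEP OF THE VIRTUAL WINDOW FOR EVERY PRIME `p`, UNCONDITIONAL: a real slot step / a real
# ROTATION of the light-pair power-cone chain is shadowed by a PURE slot step of the framed virtual partner (cell `res-dim4-pi`,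
# K2(p) lane, rung-1 POWER-CONE LINE «light pair of TAIL(p, p−1, 3) ∀ p», window half W4; the `p = 5` instances are res-dim4-typ-1
# g3's `…SwapTransportWindowStep` p700674 / `…WindowStepFull` p700979)

[OURS · counted 0 · cell `res-dim4-pi` · K2(p) lane (holder res-dim4-p-12 g5, rulings g5-2 (6) / g5-6) · seat res-dim4-typ-1 g5.]
Nothing here proves K2(p) for any `p`, any TAIL(p, p−1, 3), any TAIL(7, d, e), `NoIsolatedTrap p p` or resolution of singularities
in dimension ≥ 4 / characteristic `p` — NOT proved.  AI kernel work, weaker than expert review.  Transport bookkeeping for OUR frame;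
kills nothing by itself.

At `5` the step lemma carried two foreign inputs BY VALUE ((VT-u) two-state, `e_G` transfer) and a sequel file discharged them.
At general `p` both are tree theorems already — W1a `eG_transfer_prime` (inside the core W1b) and W4a′
`ResCone.cInf_translation_u_eq_zero_twoState_row_prime` — so this file is the COMPOSITION, with no binder left (the frame carries a
ROW PARAMETER: dead row of `(u,f)`-bidegree `(eu, ef)`, `eu + ef = d − 2`, FLAG `coeff (r + λ + μ + (eu+1)u + ef·f) ≠ 0`; the line
owner's GO on res-dim4-typ-1 g5's Q-FLAG, bus 2026-08-29 10:47Z / 10:50Z):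
* §1 **`virtual_step_slot_prime`** = W1b `virtual_core_slot_prime` (kept slot, Cramer translation `b′`, transported frame, relation
  at precision `M − p`, order / isolation / ledger / `e_G = 3` of the translated virtual child) ∘ W3
  `translation_eq_zero_of_frame_prime` (`b′ = 0`, (VT-u) by W4a′ at jet `d + 4 ≤ N`) ∘ W3 `frame_step_zero_prime` (the frame at
  jet `N − d`).
* §2 **`virtual_step_rotate_prime`** = W1b `virtual_core_rotate_prime` ∘ the same; the bijection becomes `π′ = π ∘ (a g)`.
DICTIONARY against `5`: `6 ↦ d + 2`, `x_f⁴ ↦ x_f^d`, `e_f ≤ 3 ↦ e_f ≤ d − 1`, dead «ū²» ↦ ROW `(eu, ef)`, flag `3u ↦ (eu+1)u + ef·f`,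
`N ≥ 12 ↦ N ≥ d + 4` (what (VT-u) reads), `Nc + 12 ≤ M ↦ Nc + 2p + 2 ≤ M`, `M − 5 ↦ M − p`, `N − 4 ↦ N − d`.
[cite: Hauser2010, §§F–G] [cite: CossartJannsenSaito2020, Thm. 3.14]
bears_on: LADDER-RESOLUTION:D157-DOOR2 (res-dim4-pi · K2(p) · power cones · virtual window step ∀ p).  Supports
stmt-ResolutionOfSingularities-16155 (helper).
-/

set_option linter.dupNamespace false -- mandated namespace of this single-conjunct summit

noncomputable section

namespace Summit.ResolutionOfSingularities.ResolutionOfSingularities.Theorems.PIDim4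

namespace SwapTransport

open MvPolynomial Finset
open Literature.AlgebraicGeometry.Resolution
open Literature.AlgebraicGeometry.Resolution.CentreBlowup
open Literature.AlgebraicGeometry.Resolution.Hauser2010
open Literature.AlgebraicGeometry.Resolution.HauserPerlega2019

variable {K : Type} [Field K] [DecidableEq K]

/-! ## §1 One window step, slot case, every prime -/

/-- **ONE STEP OF THE VIRTUAL WINDOW — SLOT CASE, every prime, unconditional.**  REAL state `A` (ledger `x_{πλ} x_{πμ}`, order
`d + 2`, `d + 1 = p`) with its honest child `A′ = step p univ (π λ) b A` in the chart of the SLOT `π λ` (isolated with certificate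
level `Nc`, order `d + 2`, `e_G = 3`, weights `≤ 1` of total `2`, `x^{r′} ∣ F′`); VIRTUAL framed state `B` (fixed letters `λ μ | u f`:
ledger `x_λ x_μ`, order `d + 2`, `x^r ∣ F`, straight residual `a·x_f^d`, exact pair ledger, dead `ū^{d−2}`-row below `N ≥ d + 4`, flag
`V ≠ 0`) related to `A` by a slot-unit-class frame `θ` along `π` at precision `M ≥ Nc + 2p + 2` with invertible free block.  THEN
`b (π μ) = 0`, and the PURE slot step `B⁺ := step p univ λ 0 B` is related to `A′` along `π` at precision `M − p` with invertible
free block, framed again at jet `N − d`, isolated with `e_G = 3`. [OURS] [cite: Hauser2010, §§F–G]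
[cite: CossartJannsenSaito2020, Thm. 3.14] -/
theorem virtual_step_slot_prime (p : ℕ) [Fact p.Prime] [CharP K p] {d : ℕ} (hdp : d + 1 = p) (hd2 : 2 ≤ d)
    {π : Equiv.Perm (Fin 4)} {la mu u f : Fin 4} (hlm : la ≠ mu) (hlu : la ≠ u) (hlf : la ≠ f) (hmu : mu ≠ u) (hmf : mu ≠ f)
    (huf : u ≠ f)
    -- the relation at precision `M`
    {A B : State K} {θ e : Fin 4 → MvPolynomial (Fin 4) K} {U E : MvPolynomial (Fin 4) K} {M : ℕ}
    (hθa : θ (π la) = X la * e la) (hθa' : θ (π mu) = X mu * e mu) (hea : constantCoeff (e la) ≠ 0)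
    (hea' : constantCoeff (e mu) ≠ 0) (hu0 : constantCoeff (θ (π u)) = 0) (hf0 : constantCoeff (θ (π f)) = 0)
    (hdet : coeff (Finsupp.single u 1) (θ (π u)) * coeff (Finsupp.single f 1) (θ (π f)) -
      coeff (Finsupp.single f 1) (θ (π u)) * coeff (Finsupp.single u 1) (θ (π f)) ≠ 0)
    (hU : constantCoeff U ≠ 0) (hE : E ∈ originIdeal K ^ M) (hrel : B.F = deletePthPowers p (U ^ p * aeval θ A.F) + E)
    -- the real state and its honest slot step
    (hoA : ordZero A.F = ((d + 2 : ℕ) : ℕ∞)) (hrA : A.r = Finsupp.single (π la) 1 + Finsupp.single (π mu) 1) {A' : State K}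
    {b : Fin 4 → K} (hbj : b (π la) = 0) (hstep : A' = CentreBlowup.step p Finset.univ (π la) b A)
    (hisoA' : IsIsolated p A'.F) {Nc : ℕ} (hcert : originIdeal K ^ Nc ≤ singLocusIdeal p A'.F ⊔ originIdeal K ^ (Nc + 1))
    (hoA' : ordZero A'.F = ((d + 2 : ℕ) : ℕ∞)) (he3A' : Module.finrank K (ResCone.resVertex A') = 3) (hw1 : ∀ i, A'.r i ≤ 1)
    (hdegA' : A'.r.degree = 2) (hdivA' : ∀ e ∈ A'.F.support, A'.r ≤ e)
    -- the virtual frame at jet `N`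
    (hoB : ordZero B.F = ((d + 2 : ℕ) : ℕ∞)) (hrB : B.r = Finsupp.single la 1 + Finsupp.single mu 1)
    (hdivB : ∀ e ∈ B.F.support, B.r ≤ e) {a : K} (ha : a ≠ 0) (hformB : ResCone.resForm B = C a * X f ^ d)
    (hledB : ∀ e ∈ B.F.support, e f ≤ d - 1 → 2 ≤ e la ∧ 2 ≤ e mu) {N eu ef : ℕ} (hef : eu + ef = d - 2) (hN : d + 4 ≤ N)
    (hrowB : ∀ e ∈ B.F.support, e.degree < N → ¬ (e u = eu ∧ e f = ef))
    (hVB : coeff (B.r + (Finsupp.single la 1 + Finsupp.single mu 1 + Finsupp.single u (eu + 1) + Finsupp.single f ef)) B.F ≠ 0)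
    (hM : Nc + 2 * p + 2 ≤ M) :
    b (π mu) = 0 ∧ A'.r = Finsupp.single (π la) 1 + Finsupp.single (π mu) 1 ∧
    ∃ (θ' e' : Fin 4 → MvPolynomial (Fin 4) K) (U' E' : MvPolynomial (Fin 4) K),
      θ' (π la) = X la * e' la ∧ θ' (π mu) = X mu * e' mu ∧ constantCoeff (e' la) ≠ 0 ∧ constantCoeff (e' mu) ≠ 0 ∧
      constantCoeff (θ' (π u)) = 0 ∧ constantCoeff (θ' (π f)) = 0 ∧
      coeff (Finsupp.single u 1) (θ' (π u)) * coeff (Finsupp.single f 1) (θ' (π f)) -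
        coeff (Finsupp.single f 1) (θ' (π u)) * coeff (Finsupp.single u 1) (θ' (π f)) ≠ 0 ∧
      constantCoeff U' ≠ 0 ∧ E' ∈ originIdeal K ^ (M - p) ∧
      (CentreBlowup.step p Finset.univ la 0 B).F = deletePthPowers p (U' ^ p * aeval θ' A'.F) + E' ∧
      -- the frame of the virtual child at jet `N − d`
      ordZero (CentreBlowup.step p Finset.univ la 0 B).F = ((d + 2 : ℕ) : ℕ∞) ∧
      (CentreBlowup.step p Finset.univ la 0 B).r = Finsupp.single la 1 + Finsupp.single mu 1 ∧
      (∀ e ∈ (CentreBlowup.step p Finset.univ la 0 B).F.support, (CentreBlowup.step p Finset.univ la 0 B).r ≤ e) ∧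
      (∃ a' : K, a' ≠ 0 ∧ ResCone.resForm (CentreBlowup.step p Finset.univ la 0 B) = C a' * X f ^ d) ∧
      (∀ e ∈ (CentreBlowup.step p Finset.univ la 0 B).F.support, e f ≤ d - 1 → 2 ≤ e la ∧ 2 ≤ e mu) ∧
      (∀ e ∈ (CentreBlowup.step p Finset.univ la 0 B).F.support, e.degree < N - d → ¬ (e u = eu ∧ e f = ef)) ∧
      coeff ((CentreBlowup.step p Finset.univ la 0 B).r + (Finsupp.single la 1 + Finsupp.single mu 1 + Finsupp.single u (eu + 1) + Finsupp.single f ef))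
        (CentreBlowup.step p Finset.univ la 0 B).F ≠ 0 ∧
      IsIsolated p (CentreBlowup.step p Finset.univ la 0 B).F ∧
      Module.finrank K (ResCone.resVertex (CentreBlowup.step p Finset.univ la 0 B)) = 3 := by
  have hdp2 : d + 2 = p + 1 := by omega
  have hoA1 : ordZero A.F = ((p + 1 : ℕ) : ℕ∞) := by rw [hoA, hdp2]
  have hoA'1 : ordZero A'.F = ((p + 1 : ℕ) : ℕ∞) := by rw [hoA', hdp2]
  have hoB1 : ordZero B.F = ((p + 1 : ℕ) : ℕ∞) := by rw [hoB, hdp2]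
  -- (1)–(7): the regime-free core
  obtain ⟨hbmu, hrA', b', θ', e', U', E', hb'la, hb'mu, hθn, hθn', hen, hen', hu0', hf0', hdet', hU', hE', hrel', hoBp, hrBp,
    hdivBp, hisoBp, he3Bp⟩ :=
    virtual_core_slot_prime p hlm hlu hlf hmu hmf huf hθa hθa' hea hea' hu0 hf0 hdet hU hE hrel hoA1 hrA hbj hstep hisoA' hcert
      hoA'1 he3A' hw1 hdegA' hdivA' hoB1 hrB hdivB hM
  rw [← hdp2] at hoBp
  -- (8) (VT): the virtual translation is zero, the virtual child is the PURE step
  have hb'0 : b' = 0 :=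
    translation_eq_zero_of_frame_prime p hdp hlm hlu hlf hmu hmf huf hoB hrB hdivB ha hformB hb'la hb'mu hoBp he3Bp
      (fun β h6 h3 => ResCone.cInf_translation_u_eq_zero_twoState_row_prime p hdp hd2 hlm hlu hlf hmu hmf huf (Or.inl rfl) hrB hoB
        hdivB ha hformB hledB hef hN hrowB hVB h6 h3)
  rw [hb'0] at hrel' hisoBp hoBp he3Bp
  -- (9) frame propagation
  obtain ⟨hrBp0, hdivBp0, hform', hled', hrow', hV'⟩ :=
    frame_step_zero_prime p hdp hd2 hlm hlu hlf hmu hmf huf hoB hrB hdivB ha hformB hledB hef hrowB hVB hoBp he3Bp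
  exact ⟨hbmu, hrA', θ', e', U', E', hθn, hθn', hen, hen', hu0', hf0', hdet', hU', hE', hrel', hoBp, hrBp0, hdivBp0, hform', hled',
    hrow', hV', hisoBp, he3Bp⟩

/-! ## §2 One window step, rotation case, every prime -/

/-- **ONE STEP OF THE VIRTUAL WINDOW — ROTATION CASE, every prime, unconditional.**  Virtual slots `a` (translated away by the real
step: `b (π a) ≠ 0`) and `a′` (kept), free letters `{u, f} = {g, g̃}` (`f` the contact letter of the virtual frame); the REAL chain
steps in the chart of the free letter `π g`.  The virtual partner steps PURELY in the chart of the slot `a`, and the new bijection is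
`π′ = π ∘ (a g)`: `π′ a = π g`, `π′ g = π a`. [OURS] [cite: Hauser2010, §§F–G] [cite: CossartJannsenSaito2020, Thm. 3.14] -/
theorem virtual_step_rotate_prime (p : ℕ) [Fact p.Prime] [CharP K p] {d : ℕ} (hdp : d + 1 = p) (hd2 : 2 ≤ d)
    {π : Equiv.Perm (Fin 4)} {a a' u f g gt : Fin 4} (haa' : a ≠ a') (hau : a ≠ u) (haf : a ≠ f) (ha'u : a' ≠ u) (ha'f : a' ≠ f)
    (huf : u ≠ f) (hg : (g = u ∧ gt = f) ∨ (g = f ∧ gt = u))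
    -- the relation at precision `M`
    {A B : State K} {θ e : Fin 4 → MvPolynomial (Fin 4) K} {U E : MvPolynomial (Fin 4) K} {M : ℕ}
    (hθa : θ (π a) = X a * e a) (hθa' : θ (π a') = X a' * e a') (hea : constantCoeff (e a) ≠ 0)
    (hea' : constantCoeff (e a') ≠ 0) (hu0 : constantCoeff (θ (π u)) = 0) (hf0 : constantCoeff (θ (π f)) = 0)
    (hdet : coeff (Finsupp.single u 1) (θ (π u)) * coeff (Finsupp.single f 1) (θ (π f)) -
      coeff (Finsupp.single f 1) (θ (π u)) * coeff (Finsupp.single u 1) (θ (π f)) ≠ 0)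
    (hU : constantCoeff U ≠ 0) (hE : E ∈ originIdeal K ^ M) (hrel : B.F = deletePthPowers p (U ^ p * aeval θ A.F) + E)
    -- the real state and its honest rotation step
    (hoA : ordZero A.F = ((d + 2 : ℕ) : ℕ∞)) {A' : State K} {b : Fin 4 → K} (hbj : b (π g) = 0) (hba : b (π a) ≠ 0)
    (hba' : b (π a') = 0) (hstep : A' = CentreBlowup.step p Finset.univ (π g) b A)
    (hisoA' : IsIsolated p A'.F) {Nc : ℕ} (hcert : originIdeal K ^ Nc ≤ singLocusIdeal p A'.F ⊔ originIdeal K ^ (Nc + 1))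
    (hoA' : ordZero A'.F = ((d + 2 : ℕ) : ℕ∞)) (he3A' : Module.finrank K (ResCone.resVertex A') = 3)
    (hrA' : A'.r = Finsupp.single (π g) 1 + Finsupp.single (π a') 1) (hdivA' : ∀ e ∈ A'.F.support, A'.r ≤ e)
    -- the virtual frame at jet `N`
    (hoB : ordZero B.F = ((d + 2 : ℕ) : ℕ∞)) (hrB : B.r = Finsupp.single a 1 + Finsupp.single a' 1)
    (hdivB : ∀ e ∈ B.F.support, B.r ≤ e) {aB : K} (haB : aB ≠ 0) (hformB : ResCone.resForm B = C aB * X f ^ d)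
    (hledB : ∀ e ∈ B.F.support, e f ≤ d - 1 → 2 ≤ e a ∧ 2 ≤ e a') {N eu ef : ℕ} (hef : eu + ef = d - 2) (hN : d + 4 ≤ N)
    (hrowB : ∀ e ∈ B.F.support, e.degree < N → ¬ (e u = eu ∧ e f = ef))
    (hVB : coeff (B.r + (Finsupp.single a 1 + Finsupp.single a' 1 + Finsupp.single u (eu + 1) + Finsupp.single f ef)) B.F ≠ 0)
    (hM : Nc + 2 * p + 2 ≤ M) :
    ∃ (π' : Equiv.Perm (Fin 4)) (θ' e' : Fin 4 → MvPolynomial (Fin 4) K) (U' E' : MvPolynomial (Fin 4) K),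
      π' = (Equiv.swap a g).trans π ∧ π' a = π g ∧ π' a' = π a' ∧ π' g = π a ∧ π' gt = π gt ∧
      θ' (π' a) = X a * e' a ∧ θ' (π' a') = X a' * e' a' ∧ constantCoeff (e' a) ≠ 0 ∧ constantCoeff (e' a') ≠ 0 ∧
      constantCoeff (θ' (π' u)) = 0 ∧ constantCoeff (θ' (π' f)) = 0 ∧
      coeff (Finsupp.single u 1) (θ' (π' u)) * coeff (Finsupp.single f 1) (θ' (π' f)) -
        coeff (Finsupp.single f 1) (θ' (π' u)) * coeff (Finsupp.single u 1) (θ' (π' f)) ≠ 0 ∧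
      constantCoeff U' ≠ 0 ∧ E' ∈ originIdeal K ^ (M - p) ∧
      (CentreBlowup.step p Finset.univ a 0 B).F = deletePthPowers p (U' ^ p * aeval θ' A'.F) + E' ∧
      -- the frame of the virtual child at jet `N − d`
      ordZero (CentreBlowup.step p Finset.univ a 0 B).F = ((d + 2 : ℕ) : ℕ∞) ∧
      (CentreBlowup.step p Finset.univ a 0 B).r = Finsupp.single a 1 + Finsupp.single a' 1 ∧
      (∀ e ∈ (CentreBlowup.step p Finset.univ a 0 B).F.support, (CentreBlowup.step p Finset.univ a 0 B).r ≤ e) ∧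
      (∃ c : K, c ≠ 0 ∧ ResCone.resForm (CentreBlowup.step p Finset.univ a 0 B) = C c * X f ^ d) ∧
      (∀ e ∈ (CentreBlowup.step p Finset.univ a 0 B).F.support, e f ≤ d - 1 → 2 ≤ e a ∧ 2 ≤ e a') ∧
      (∀ e ∈ (CentreBlowup.step p Finset.univ a 0 B).F.support, e.degree < N - d → ¬ (e u = eu ∧ e f = ef)) ∧
      coeff ((CentreBlowup.step p Finset.univ a 0 B).r + (Finsupp.single a 1 + Finsupp.single a' 1 + Finsupp.single u (eu + 1) + Finsupp.single f ef))
        (CentreBlowup.step p Finset.univ a 0 B).F ≠ 0 ∧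
      IsIsolated p (CentreBlowup.step p Finset.univ a 0 B).F ∧
      Module.finrank K (ResCone.resVertex (CentreBlowup.step p Finset.univ a 0 B)) = 3 := by
  have hdp2 : d + 2 = p + 1 := by omega
  have hoA1 : ordZero A.F = ((p + 1 : ℕ) : ℕ∞) := by rw [hoA, hdp2]
  have hoA'1 : ordZero A'.F = ((p + 1 : ℕ) : ℕ∞) := by rw [hoA', hdp2]
  have hoB1 : ordZero B.F = ((p + 1 : ℕ) : ℕ∞) := by rw [hoB, hdp2]
  -- (1)–(7): the regime-free core
  obtain ⟨π', b', θ', e', U', E', hπ', hπ'a, hπ'a', hπ'g, hπ'gt, hb'a, hb'a', hθn, hθn', hen, hen', hu0', hf0', hdet', hU', hE',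
    hrel', hoBp, hrBp, hdivBp, hisoBp, he3Bp⟩ :=
    virtual_core_rotate_prime p haa' hau haf ha'u ha'f huf hg hθa hθa' hea hea' hu0 hf0 hdet hU hE hrel hoA1 hbj hba hba' hstep
      hisoA' hcert hoA'1 he3A' hrA' hdivA' hoB1 hrB hdivB hM
  rw [← hdp2] at hoBp
  -- (8) (VT): the virtual translation is zero, the virtual child is the PURE step
  have hb'0 : b' = 0 :=
    translation_eq_zero_of_frame_prime p hdp haa' hau haf ha'u ha'f huf hoB hrB hdivB haB hformB hb'a hb'a' hoBp he3Bp
      (fun β h6 h3 => ResCone.cInf_translation_u_eq_zero_twoState_row_prime p hdp hd2 haa' hau haf ha'u ha'f huf (Or.inl rfl) hrB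
        hoB hdivB haB hformB hledB hef hN hrowB hVB h6 h3)
  rw [hb'0] at hrel' hisoBp hoBp he3Bp
  -- (9) frame propagation
  obtain ⟨hrBp0, hdivBp0, hform', hled', hrow', hV'⟩ :=
    frame_step_zero_prime p hdp hd2 haa' hau haf ha'u ha'f huf hoB hrB hdivB haB hformB hledB hef hrowB hVB hoBp he3Bp
  exact ⟨π', θ', e', U', E', hπ', hπ'a, hπ'a', hπ'g, hπ'gt, hθn, hθn', hen, hen', hu0', hf0', hdet', hU', hE', hrel', hoBp, hrBp0,
    hdivBp0, hform', hled', hrow', hV', hisoBp, he3Bp⟩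

end SwapTransport

end Summit.ResolutionOfSingularities.ResolutionOfSingularities.Theorems.PIDim4

end
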